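import Summits.BirchSwinnertonDyer.BirchSwinnertonDyer.Theorems.PrintCf2RubinValueTwoEllipticUnitsGlobalUnits
import HarnessLib

/-!
# de Shalit II.2.4 (ii) in the `Γ_K`-monoid of global elliptic units — `σ_𝔞 e(𝔠) · e(𝔞)^{N𝔠} = e(𝔞𝔠)` — and the resulting ADDITIVE
# BOOKKEEPING of the one-`𝔓` measures: `i_𝔓((σ_𝔞 e(𝔠))_𝔓) = i_𝔓(e(𝔞𝔠)_𝔓) − N𝔠 · i_𝔓(e(𝔞)_𝔓)` (II.4.10 Step 2 at the measure level)

Cell `bsd-print-cf2`, width seat `bsd-line-cf2-p1-w8` g11 (piece (H6a) of the measure side: the Galois conjugates of the elliptic units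
that appear in the coset formula II.4.7 (16) are eliminated in favour of the elliptic units THEMSELVES); `--supports` the banked S3a item
stmt-BirchSwinnertonDyer-24721 (helper, Theses-free).  THEOREMS ONLY; CONDITIONAL on the published named facts
`DeShalit1987.prop24_ii_galoisAction`, `prop24_iii_unit`, `prop25_i_normRelation` (hypotheses, never asserted).

PRINT (de Shalit II.2.4 (ii), p. 44: "`Θ(v; L, 𝔞)^{σ_𝔠} = Θ(v; 𝔠⁻¹L, 𝔞)`" and "`Θ(v; 𝔠⁻¹L, 𝔞) · Θ(v; L, 𝔠)^{N𝔞} = Θ(v; L, 𝔞𝔠)`"; II.4.10, p. 64,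
Step 2 of the proof of the interpolation formula: the conjugates `σ_𝔠 e_n(𝔞)` entering (16) are evaluated through this relation, so that only
the numbers `δ_k(e(𝔟))` of elliptic units `e(𝔟)` remain, `𝔟` running over `𝔞𝔠` and `𝔠`).  The tree has the SYMMETRIC form of II.2.4 (ii)
(`hrel_ellipticUnitsGlobal`: `g_𝔠 • e(𝔞) · e(𝔠)^{N𝔞} = g_𝔞 • e(𝔠) · e(𝔞)^{N𝔠}`, the `hrel` of the division theorem) and the complex-analytic
asymmetric form (`isThetaValueOne_algClosureEmb_artin_mul_pow`).  THIS file proves, for ANY lift `g_𝔞 ∈ Γ_K` of the Artin symbols of `𝔞` on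
every `K(𝔪v^{m+1})` and ANY representative families `x^𝔞, x^𝔠, x^{𝔞𝔠}`:

* §1 ★★ `smul_ellipticUnitsGlobal_mul_pow_eq` — **`g_𝔞 • e(𝔠) · e(𝔞)^{N𝔠} = e(𝔞𝔠)`** in `GlobalNormCoherentUnits` (levelwise II.2.4 (ii) +
  well-definedness of `Θ(1; 𝔤, 𝔟)`, `isThetaValueOne_unique`);
* §2 `localMeasureFamily_μ_one` / `localMeasureFamily_μ_pow` (`i_𝔓(1) = 0`, `i_𝔓(β^N) = N·i_𝔓(β)`), ★★
  `localMeasureFamily_μ_smul_ellipticUnitsGlobal_add` — **`i_𝔓((g_𝔞 • e(𝔠))_𝔓) + N𝔠 · i_𝔓(e(𝔞)_𝔓) = i_𝔓(e(𝔞𝔠)_𝔓)` levelwise**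
  (`ofGlobalUnits_mul/_pow`, additivity of the one-`𝔓` family), and ★★ `integral_localMeasureFamily_smul_ellipticUnitsGlobal` — **for every
  tower-continuous `f`: `∫ f d i_𝔓((g_𝔞 • e(𝔠))_𝔓) = ∫ f d i_𝔓(e(𝔞𝔠)_𝔓) − N𝔠 · ∫ f d i_𝔓(e(𝔞)_𝔓)`** (`integral_add_distribution`,
  `integral_smul`) — de Shalit's "`δ_k(σ_𝔞 e(𝔠)) = δ_k(e(𝔞𝔠)) − N𝔠·δ_k(e(𝔞))`" for all integrands at once.

HONEST FRAMING: an assembly of accepted kernel theorems over published named facts; nothing here closes a crux; no summit statement is proved;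
BSD is not proved by any of this.

## References
* [deShalit1987] E. de Shalit, *Iwasawa theory of elliptic curves with complex multiplication* (1987), II.2.4 Proposition (ii) (p. 44),
  II.4.10 (p. 63–64), II.4.7 (16) (p. 60), I.3.4 Lemma (i) (p. 18), II.4.9 (24) (p. 62).
-/

-- the summit namespace `Summit.BirchSwinnertonDyer.BirchSwinnertonDyer` repeats the problem name by design (D-0017)
set_option linter.dupNamespace false
set_option autoImplicit false

noncomputable section

open scoped Classical nonZeroDivisors
open scoped NumberField
open Field IsDedekindDomain IsDedekindDomain.HeightOneSpectrum ValuativeRel IsLocalRing MvPowerSeries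
open Literature.NumberTheory.NumberFields
open Literature.NumberTheory.GaloisRepresentations Literature.NumberTheory.GaloisRepresentations.IsNonarchimedeanLocalField
  Literature.NumberTheory.GaloisRepresentations.LubinTate Literature.NumberTheory.GaloisRepresentations.ArtinLocalGlobal
  Literature.NumberTheory.PAdicHodge
open Literature.NumberTheory.EllipticCurves Literature.NumberTheory.EllipticCurves.GroupDistribution
open Literature.NumberTheory.ComplexMultiplication.EllipticUnits
open Literature.NumberTheory.LFunctions.AbelianDensity (artinSymbol)
open Summit.BirchSwinnertonDyer.BirchSwinnertonDyer.Theorems.PrintCf2.EllipticUnitsLocal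

namespace Summit.BirchSwinnertonDyer.BirchSwinnertonDyer.Theorems.PrintCf2.EllipticUnitsGlobal

variable {K : Type} [Field K] [NumberField K] {𝔪 : Ideal (𝓞 K)} {v : HeightOneSpectrum (𝓞 K)}

attribute [local instance] GlobalNormCoherentUnits.instCommMonoid GlobalNormCoherentUnits.galAction

/-! ## §1. II.2.4 (ii), asymmetric form, in the `Γ_K`-monoid: `g_𝔞 • e(𝔠) · e(𝔞)^{N𝔠} = e(𝔞𝔠)` -/

section Global

variable (h24ii : DeShalit1987.prop24_ii_galoisAction) (h24iii : DeShalit1987.prop24_iii_unit)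
  (h25 : DeShalit1987.prop25_i_normRelation) (hK : IsImaginaryQuadratic K) (ι : K →+* ℂ)
  (h𝔪0 : 𝔪 ≠ ⊥) (h𝔪1 : 𝔪 ≠ ⊤) (hv : ¬ 𝔪 ≤ v.asIdeal) (hw : ∀ u : (𝓞 K)ˣ, (u : 𝓞 K) - 1 ∈ 𝔪 → u = 1)

include h24ii in
/-- ★★ **II.2.4 (ii), ASYMMETRIC FORM, for the global elliptic units**: for non-zero `𝔞`, `𝔠` prime to `𝔪v`, `𝔟 = 𝔞𝔠`, representative families
`x^𝔞, x^𝔠, x^𝔟` under `Θ(1; 𝔪v^{m+1}, ·)`, and ANY `g_𝔞 ∈ Γ_K` acting on every `K(𝔪v^{m+1})` as the Artin symbol of `𝔞`: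
**`g_𝔞 • e(𝔠) · e(𝔞)^{N𝔠} = e(𝔟)`** — levelwise `ι̂(σ_𝔞 x^𝔠_m) · ι̂(x^𝔞_m)^{N𝔠} = Θ(1; 𝔪v^{m+1}, 𝔠𝔞)` (`isThetaValueOne_algClosureEmb_artin_mul_pow`) and
`Θ(1; 𝔤, 𝔟)` is well defined (`isThetaValueOne_unique`).  GIVEN II.2.4 (ii). [cite: deShalit1987, II.2.4 Proposition (ii) (p. 44), II.4.10 (p. 64)] -/
theorem smul_ellipticUnitsGlobal_mul_pow_eq {𝔞 𝔠 𝔟 : Ideal (𝓞 K)} (h𝔞0 : 𝔞 ≠ ⊥) (h𝔞c : IsCoprime 𝔞 (𝔪 * v.asIdeal))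
    (h𝔠0 : 𝔠 ≠ ⊥) (h𝔠c : IsCoprime 𝔠 (𝔪 * v.asIdeal)) (h𝔟0 : 𝔟 ≠ ⊥) (h𝔟c : IsCoprime 𝔟 (𝔪 * v.asIdeal)) (h𝔟 : 𝔟 = 𝔞 * 𝔠)
    (xa : ∀ m : ℕ, rayClassField K (𝔪 * v.asIdeal ^ (m + 1)))
    (hxa : ∀ m, IsThetaValueOne ι (𝔪 * v.asIdeal ^ (m + 1)) 𝔞
      (algClosureEmb ι ((xa m : rayClassField K (𝔪 * v.asIdeal ^ (m + 1))) : AlgebraicClosure K)))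
    (xc : ∀ m : ℕ, rayClassField K (𝔪 * v.asIdeal ^ (m + 1)))
    (hxc : ∀ m, IsThetaValueOne ι (𝔪 * v.asIdeal ^ (m + 1)) 𝔠
      (algClosureEmb ι ((xc m : rayClassField K (𝔪 * v.asIdeal ^ (m + 1))) : AlgebraicClosure K)))
    (xb : ∀ m : ℕ, rayClassField K (𝔪 * v.asIdeal ^ (m + 1)))
    (hxb : ∀ m, IsThetaValueOne ι (𝔪 * v.asIdeal ^ (m + 1)) 𝔟
      (algClosureEmb ι ((xb m : rayClassField K (𝔪 * v.asIdeal ^ (m + 1))) : AlgebraicClosure K)))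
    (ga : absoluteGaloisGroup K)
    (hga : ∀ m : ℕ, absRestrictNormalHom (rayClassField K (𝔪 * v.asIdeal ^ (m + 1))) ga =
      artinSymbol (galFrob K (rayClassField K (𝔪 * v.asIdeal ^ (m + 1)))) 𝔞) :
    ga • ellipticUnitsGlobal h24iii h25 hK ι h𝔪0 h𝔪1 hv hw h𝔠0 h𝔠c xc hxc *
        ellipticUnitsGlobal h24iii h25 hK ι h𝔪0 h𝔪1 hv hw h𝔞0 h𝔞c xa hxa ^ Ideal.absNorm 𝔠 =
      ellipticUnitsGlobal h24iii h25 hK ι h𝔪0 h𝔪1 hv hw h𝔟0 h𝔟c xb hxb := by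
  refine GlobalNormCoherentUnits.ext_coe fun m ↦ ?_
  rw [GlobalNormCoherentUnits.coe_val_mul, GlobalNormCoherentUnits.coe_val_pow, GlobalNormCoherentUnits.val_smul,
    val_ellipticUnitsGlobal, val_ellipticUnitsGlobal, val_ellipticUnitsGlobal, hga m]
  apply (algClosureEmb ι).injective
  rw [map_mul, map_pow]
  have h1 := isThetaValueOne_algClosureEmb_artin_mul_pow h24ii hK ι (mul_pow_succ_ne_bot h𝔪0 v m) (mul_pow_succ_ne_top 𝔪 v m)
    h𝔠0 (isCoprime_mul_pow_succ h𝔠c m) h𝔞0 (isCoprime_mul_pow_succ h𝔞c m) (hxc m) (hxa m)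
  rw [mul_comm 𝔠 𝔞, ← h𝔟] at h1
  exact isThetaValueOne_unique (mul_pow_succ_ne_top 𝔪 v m) h1 (hxb m)

end Global

/-! ## §2. The additive bookkeeping of the one-`𝔓` measures -/

section Local

attribute [local instance] ltNormUniformSpace ltNormIsUniformAddGroup rk1 nF nE fintypeResidueField
attribute [local instance] RelNormCoherentUnits.instCommMonoid

variable [NumberField.IsTotallyComplex K]
  (h24ii : DeShalit1987.prop24_ii_galoisAction) (h24iii : DeShalit1987.prop24_iii_unit) (h25 : DeShalit1987.prop25_i_normRelation)
  (hK : IsImaginaryQuadratic K) (ι : K →+* ℂ)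
  (h𝔪0 : 𝔪 ≠ ⊥) (h𝔪1 : 𝔪 ≠ ⊤) (hv : ¬ 𝔪 ≤ v.asIdeal) (hw : ∀ u : (𝓞 K)ˣ, (u : 𝓞 K) - 1 ∈ 𝔪 → u = 1)
  (hq : residueFieldCard (v.adicCompletion K) = 2)
  (h2 : (valuation (v.adicCompletion K)).IsUniformizer ((((2 : ℕ) : 𝒪[v.adicCompletion K]) : v.adicCompletion K)))
  (u : 𝒪[v.adicCompletion K]ˣ)
  {α : 𝓞 K} (hα0 : α ≠ 0) (hα𝔪 : α - 1 ∈ 𝔪) (hαw : ∀ w : HeightOneSpectrum (𝓞 K), w ≠ v → α ∉ w.asIdeal)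
  {f : ℕ} (hαπ : ((α : K) : v.adicCompletion K) =
    ((((u : 𝒪[v.adicCompletion K]) * ((2 : ℕ) : 𝒪[v.adicCompletion K]) : 𝒪[v.adicCompletion K]) : v.adicCompletion K)) ^ f)
  (E : IntermediateField (v.adicCompletion K) (AlgebraicClosure (v.adicCompletion K)))
  [FiniteDimensional (v.adicCompletion K) E] [IsGalois (v.adicCompletion K) E] (hE : E ≤ maxUnramified (v.adicCompletion K))
  (hdegE : ∀ w : WeilGroup (v.adicCompletion K),
    WeilGroup.toAbsGalois (v.adicCompletion K) w ∈ E.fixingSubgroup → (f : ℤ) ∣ WeilGroup.deg w)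
  {σ₀ : absoluteGaloisGroup (v.adicCompletion K)} (hσ₀ : IsAbsArithFrob σ₀)
  {ε : (maxUnramifiedCompletion (v.adicCompletion K))ˣ}
  (hε : maxUnramifiedCompletion.galAut (v.adicCompletion K) σ₀ (ε : maxUnramifiedCompletion (v.adicCompletion K)) =
    algebraMap 𝒪[v.adicCompletion K] (maxUnramifiedCompletion (v.adicCompletion K)) (u : 𝒪[v.adicCompletion K]) *
      (ε : maxUnramifiedCompletion (v.adicCompletion K)))
  (θ : CompletedAlgClosure (v.adicCompletion K) →+* ℂ_[2])
  (hθ1 : ∀ z : CBall (v.adicCompletion K), ‖θ (z : CompletedAlgClosure (v.adicCompletion K))‖ ≤ 1)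
  (j : unitBall E →+* UnrCoeff (v.adicCompletion K))
  (hjC : (algebraMap (UnrCoeff (v.adicCompletion K)) (CBall (v.adicCompletion K))).comp j = unitBallToCBall E)
  (e₂ : v.adicCompletionIntegers K ≃+* ℤ_[2])
  (ψ : (n : ℕ) → ↥(absRestrictNormalHom (rayClassField K 𝔪)).ker ⧸ (rayAdicTower (𝔪 := 𝔪) h𝔪0 v).U n → ZMod (2 ^ (n + 1)))
  (hψ : ∀ (n : ℕ) (g : ↥(absRestrictNormalHom (rayClassField K 𝔪)).ker), g ∈ (rayAdicTower (𝔪 := 𝔪) h𝔪0 v).U 0 →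
    ψ n ((rayAdicTower (𝔪 := 𝔪) h𝔪0 v).proj n g) =
      PadicInt.toZModPow (n + 1) ((((Units.map (e₂ : v.adicCompletionIntegers K →+* ℤ_[2]).toMonoidHom).comp
        (rayAdicCharacter h𝔪0 hv hw))⁻¹ g : ℤ_[2]ˣ) : ℤ_[2]))
  [hN : ∀ n, ((rayAdicTower (𝔪 := 𝔪) h𝔪0 v).U n).Normal]

set_option maxHeartbeats 800000 in
/-- `i_𝔓(1) = 0` (additivity at `1 · 1 = 1`). [cite: deShalit1987, I.3.4 Lemma (i) (p. 18)] -/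
theorem localMeasureFamily_μ_one (n : ℕ) (a : ↥(absRestrictNormalHom (rayClassField K 𝔪)).ker ⧸ (rayAdicTower (𝔪 := 𝔪) h𝔪0 v).U n) :
    (localMeasureFamily h𝔪0 hv hw hq h2 u E hE hσ₀ hε θ hθ1 j hjC e₂ ψ hψ 1).μ n a = 0 := by
  have h := localMeasureFamily_μ_mul h𝔪0 hv hw hq h2 u E hE hσ₀ hε θ hθ1 j hjC e₂ ψ hψ 1 1 n a
  rw [one_mul] at h
  linear_combination -h

set_option maxHeartbeats 800000 in
/-- `i_𝔓(β^N) = N · i_𝔓(β)` levelwise (additivity). [cite: deShalit1987, I.3.4 Lemma (i) (p. 18), II.4.6 (p. 59)] -/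
theorem localMeasureFamily_μ_pow (β : RelNormCoherentUnits (isUniformizer_unit_mul h2 u) E) (N n : ℕ)
    (a : ↥(absRestrictNormalHom (rayClassField K 𝔪)).ker ⧸ (rayAdicTower (𝔪 := 𝔪) h𝔪0 v).U n) :
    (localMeasureFamily h𝔪0 hv hw hq h2 u E hE hσ₀ hε θ hθ1 j hjC e₂ ψ hψ (β ^ N)).μ n a =
      (N : ℂ_[2]) * (localMeasureFamily h𝔪0 hv hw hq h2 u E hE hσ₀ hε θ hθ1 j hjC e₂ ψ hψ β).μ n a := by
  induction N with
  | zero => rw [pow_zero, localMeasureFamily_μ_one, Nat.cast_zero, zero_mul]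
  | succ N ih => rw [pow_succ, localMeasureFamily_μ_mul, ih, Nat.cast_succ]; ring

set_option maxHeartbeats 800000 in
include h24ii in
/-- ★★ **`i_𝔓((g_𝔞 • e(𝔠))_𝔓) + N𝔠 · i_𝔓(e(𝔞)_𝔓) = i_𝔓(e(𝔞𝔠)_𝔓)` levelwise** (II.2.4 (ii) `g_𝔞 • e(𝔠) · e(𝔞)^{N𝔠} = e(𝔞𝔠)`,
`ofGlobalUnits_mul/_pow`, additivity of the one-`𝔓` family) — de Shalit II.4.10 Step 2 at the level of measures.  GIVEN II.2.4 (ii).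
[cite: deShalit1987, II.4.10 (p. 64), II.2.4 Proposition (ii) (p. 44), I.3.4 Lemma (i) (p. 18)] -/
theorem localMeasureFamily_μ_smul_ellipticUnitsGlobal_add {𝔞 𝔠 𝔟 : Ideal (𝓞 K)} (h𝔞0 : 𝔞 ≠ ⊥) (h𝔞c : IsCoprime 𝔞 (𝔪 * v.asIdeal))
    (h𝔠0 : 𝔠 ≠ ⊥) (h𝔠c : IsCoprime 𝔠 (𝔪 * v.asIdeal)) (h𝔟0 : 𝔟 ≠ ⊥) (h𝔟c : IsCoprime 𝔟 (𝔪 * v.asIdeal)) (h𝔟 : 𝔟 = 𝔞 * 𝔠)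
    (xa : ∀ m : ℕ, rayClassField K (𝔪 * v.asIdeal ^ (m + 1)))
    (hxa : ∀ m, IsThetaValueOne ι (𝔪 * v.asIdeal ^ (m + 1)) 𝔞
      (algClosureEmb ι ((xa m : rayClassField K (𝔪 * v.asIdeal ^ (m + 1))) : AlgebraicClosure K)))
    (xc : ∀ m : ℕ, rayClassField K (𝔪 * v.asIdeal ^ (m + 1)))
    (hxc : ∀ m, IsThetaValueOne ι (𝔪 * v.asIdeal ^ (m + 1)) 𝔠
      (algClosureEmb ι ((xc m : rayClassField K (𝔪 * v.asIdeal ^ (m + 1))) : AlgebraicClosure K)))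
    (xb : ∀ m : ℕ, rayClassField K (𝔪 * v.asIdeal ^ (m + 1)))
    (hxb : ∀ m, IsThetaValueOne ι (𝔪 * v.asIdeal ^ (m + 1)) 𝔟
      (algClosureEmb ι ((xb m : rayClassField K (𝔪 * v.asIdeal ^ (m + 1))) : AlgebraicClosure K)))
    (ga : absoluteGaloisGroup K)
    (hga : ∀ m : ℕ, absRestrictNormalHom (rayClassField K (𝔪 * v.asIdeal ^ (m + 1))) ga =
      artinSymbol (galFrob K (rayClassField K (𝔪 * v.asIdeal ^ (m + 1)))) 𝔞)
    (n : ℕ) (a : ↥(absRestrictNormalHom (rayClassField K 𝔪)).ker ⧸ (rayAdicTower (𝔪 := 𝔪) h𝔪0 v).U n) :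
    (localMeasureFamily h𝔪0 hv hw hq h2 u E hE hσ₀ hε θ hθ1 j hjC e₂ ψ hψ
        (RelNormCoherentUnits.ofGlobalUnits h𝔪0 hv hw (isUniformizer_unit_mul h2 u) hα0 hα𝔪 hαw hαπ E hE hdegE
          (ga • ellipticUnitsGlobal h24iii h25 hK ι h𝔪0 h𝔪1 hv hw h𝔠0 h𝔠c xc hxc))).μ n a +
      (Ideal.absNorm 𝔠 : ℂ_[2]) * (localMeasureFamily h𝔪0 hv hw hq h2 u E hE hσ₀ hε θ hθ1 j hjC e₂ ψ hψ
        (RelNormCoherentUnits.ofGlobalUnits h𝔪0 hv hw (isUniformizer_unit_mul h2 u) hα0 hα𝔪 hαw hαπ E hE hdegE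
          (ellipticUnitsGlobal h24iii h25 hK ι h𝔪0 h𝔪1 hv hw h𝔞0 h𝔞c xa hxa))).μ n a =
      (localMeasureFamily h𝔪0 hv hw hq h2 u E hE hσ₀ hε θ hθ1 j hjC e₂ ψ hψ
        (RelNormCoherentUnits.ofGlobalUnits h𝔪0 hv hw (isUniformizer_unit_mul h2 u) hα0 hα𝔪 hαw hαπ E hE hdegE
          (ellipticUnitsGlobal h24iii h25 hK ι h𝔪0 h𝔪1 hv hw h𝔟0 h𝔟c xb hxb))).μ n a := by
  rw [← smul_ellipticUnitsGlobal_mul_pow_eq h24ii h24iii h25 hK ι h𝔪0 h𝔪1 hv hw h𝔞0 h𝔞c h𝔠0 h𝔠c h𝔟0 h𝔟c h𝔟 xa hxa xc hxc xb hxb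
    ga hga, ofGlobalUnits_mul, ofGlobalUnits_pow, localMeasureFamily_μ_mul, localMeasureFamily_μ_pow]

set_option maxHeartbeats 800000 in
include h24ii in
/-- ★★ **`∫ f d i_𝔓((g_𝔞 • e(𝔠))_𝔓) = ∫ f d i_𝔓(e(𝔞𝔠)_𝔓) − N𝔠 · ∫ f d i_𝔓(e(𝔞)_𝔓)`** for EVERY tower-continuous `f : Gal(K̄/K(𝔪)) → ℂ₂` — de Shalit's
"`δ_k(σ_𝔞 e(𝔠)) = δ_k(e(𝔞𝔠)) − N𝔠 · δ_k(e(𝔞))`" (II.4.10 Step 2) for all integrands at once: the conjugate units entering the coset formula (16)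
are read through the elliptic units `e(𝔞𝔠)`, `e(𝔞)` themselves.  GIVEN II.2.4 (ii).
[cite: deShalit1987, II.4.10 (p. 64), II.4.7 (16)–(17) (p. 60), II.2.4 Proposition (ii) (p. 44)] -/
theorem integral_localMeasureFamily_smul_ellipticUnitsGlobal {𝔞 𝔠 𝔟 : Ideal (𝓞 K)} (h𝔞0 : 𝔞 ≠ ⊥)
    (h𝔞c : IsCoprime 𝔞 (𝔪 * v.asIdeal)) (h𝔠0 : 𝔠 ≠ ⊥) (h𝔠c : IsCoprime 𝔠 (𝔪 * v.asIdeal)) (h𝔟0 : 𝔟 ≠ ⊥)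
    (h𝔟c : IsCoprime 𝔟 (𝔪 * v.asIdeal)) (h𝔟 : 𝔟 = 𝔞 * 𝔠)
    (xa : ∀ m : ℕ, rayClassField K (𝔪 * v.asIdeal ^ (m + 1)))
    (hxa : ∀ m, IsThetaValueOne ι (𝔪 * v.asIdeal ^ (m + 1)) 𝔞
      (algClosureEmb ι ((xa m : rayClassField K (𝔪 * v.asIdeal ^ (m + 1))) : AlgebraicClosure K)))
    (xc : ∀ m : ℕ, rayClassField K (𝔪 * v.asIdeal ^ (m + 1)))
    (hxc : ∀ m, IsThetaValueOne ι (𝔪 * v.asIdeal ^ (m + 1)) 𝔠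
      (algClosureEmb ι ((xc m : rayClassField K (𝔪 * v.asIdeal ^ (m + 1))) : AlgebraicClosure K)))
    (xb : ∀ m : ℕ, rayClassField K (𝔪 * v.asIdeal ^ (m + 1)))
    (hxb : ∀ m, IsThetaValueOne ι (𝔪 * v.asIdeal ^ (m + 1)) 𝔟
      (algClosureEmb ι ((xb m : rayClassField K (𝔪 * v.asIdeal ^ (m + 1))) : AlgebraicClosure K)))
    (ga : absoluteGaloisGroup K)
    (hga : ∀ m : ℕ, absRestrictNormalHom (rayClassField K (𝔪 * v.asIdeal ^ (m + 1))) ga =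
      artinSymbol (galFrob K (rayClassField K (𝔪 * v.asIdeal ^ (m + 1)))) 𝔞)
    {f : ↥(absRestrictNormalHom (rayClassField K 𝔪)).ker → ℂ_[2]} (hf : (rayAdicTower (𝔪 := 𝔪) h𝔪0 v).IsTowerContinuous f) :
    (localMeasureFamily h𝔪0 hv hw hq h2 u E hE hσ₀ hε θ hθ1 j hjC e₂ ψ hψ
        (RelNormCoherentUnits.ofGlobalUnits h𝔪0 hv hw (isUniformizer_unit_mul h2 u) hα0 hα𝔪 hαw hαπ E hE hdegE
          (ga • ellipticUnitsGlobal h24iii h25 hK ι h𝔪0 h𝔪1 hv hw h𝔠0 h𝔠c xc hxc))).integral f =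
      (localMeasureFamily h𝔪0 hv hw hq h2 u E hE hσ₀ hε θ hθ1 j hjC e₂ ψ hψ
          (RelNormCoherentUnits.ofGlobalUnits h𝔪0 hv hw (isUniformizer_unit_mul h2 u) hα0 hα𝔪 hαw hαπ E hE hdegE
            (ellipticUnitsGlobal h24iii h25 hK ι h𝔪0 h𝔪1 hv hw h𝔟0 h𝔟c xb hxb))).integral f -
        (Ideal.absNorm 𝔠 : ℂ_[2]) * (localMeasureFamily h𝔪0 hv hw hq h2 u E hE hσ₀ hε θ hθ1 j hjC e₂ ψ hψ
          (RelNormCoherentUnits.ofGlobalUnits h𝔪0 hv hw (isUniformizer_unit_mul h2 u) hα0 hα𝔪 hαw hαπ E hE hdegE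
            (ellipticUnitsGlobal h24iii h25 hK ι h𝔪0 h𝔪1 hv hw h𝔞0 h𝔞c xa hxa))).integral f := by
  rw [eq_sub_iff_add_eq, ← GroupDistribution.integral_smul (Ideal.absNorm 𝔠 : ℂ_[2]) _ hf,
    ← GroupDistribution.integral_add_distribution _ _ hf]
  exact GroupDistribution.integral_congr_of_μ_eq _ _ (fun n a ↦ by
    rw [GroupDistribution.add_μ, GroupDistribution.smul_μ]
    exact localMeasureFamily_μ_smul_ellipticUnitsGlobal_add h24ii h24iii h25 hK ι h𝔪0 h𝔪1 hv hw hq h2 u hα0 hα𝔪 hαw hαπ E hE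
      hdegE hσ₀ hε θ hθ1 j hjC e₂ ψ hψ h𝔞0 h𝔞c h𝔠0 h𝔠c h𝔟0 h𝔟c h𝔟 xa hxa xc hxc xb hxb ga hga n a) f

end Local

end Summit.BirchSwinnertonDyer.BirchSwinnertonDyer.Theorems.PrintCf2.EllipticUnitsGlobal

end
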